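/- Free-seat work of EXTRA WIDTH SEAT `ym-line-cbag-p1-w5` (prover-ym-line-cbag-p1-w5-g2-0), route `EguchiKawaiDirectionLadder`
(ideator ym-idea-2, LINE 8), crux `TripleSmallBallMargin` (stmt-QuantumFields-27724): the two GLUE obligations (d) `CentreSymmetricProfile`
and (c) `MarginComposition` of the registered skeleton PROVED (content: planner ym-idea-2 g6's sorry-free module
HOME/l8/bc/EguchiKawaiDirectionLadderPairMass.lean, 2026-08-28T12:44Z, re-homed verbatim against the importable objects of
`EguchiKawaiDirectionLadderTripleSmallBallMarginDefs`).  The two registered stubs (a) `FreeTripleSmallBall` (XL) and (b) `OffBlockDecoupling` (L)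
stay OPEN; the Yang–Mills mass gap is NOT proved by anything here (the route bears on the barrier-ledger fact `EguchiKawaiBreakdown`). -/
import Summits.QuantumFields.YangMills.Theorems.EguchiKawaiDirectionLadderTripleSmallBallMarginDefs
import Summits.QuantumFields.YangMills.Theorems.EguchiKawaiDirectionLadderPairMassCount

/-!
# Route `EguchiKawaiDirectionLadder`, crux `TripleSmallBallMargin` (stmt-QuantumFields-27724): glue (d) and (c) proved

Objects (file `EguchiKawaiDirectionLadderTripleSmallBallMarginDefs`): `spec U` = the roots of the characteristic polynomial of the unitary
`U` (a multiset of `N` unit complex numbers), `pairMass r U = (1/N²)·Σ_{z ∈ spec U} #{w ∈ spec U : ‖z − w‖ ≤ r}`, and the Props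
`FreeTripleSmallBall` (a), `ProfileResolvedBound`, `OffBlockDecoupling` (b), `CentreSymmetricProfile` (d), `MarginComposition` (c).

* `centreSymmetricProfile_proof : CentreSymmetricProfile` — deterministic, `N`-uniform circle combinatorics: for a multiset `Λ` of `N`
  unit complex numbers with `‖Σ Λ‖ ≤ √δ·N`, take a maximiser `z⋆` of the `r`-neighbour count; pigeonhole over `K ≥ 4/ε` annuli
  `{(2i+1)r < ‖w − z⋆‖ ≤ (2i+2)r}` gives a thin one; the two-region count bounds the number of ordered `r`-close pairs by
  `B_v·B_u + (N − B_v)(N − B_u)` (heavy case) or `N·B_u` (light case, `2B_u ≤ N`), and the trace sees the big ball: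
  `2B_u − N ≤ √δ·N + B_u·ρ₁`; with `(2K+3)r ≤ ε/2 ≤ 1/4` this is `≤ ((1+δ)/2 + ε)·N²` (`PairMassCount.sum_ballCount_le`).  The bound is
  tight at two antipodal clusters of masses `(1 ± √δ)/2`.
* `marginComposition_proof : MarginComposition` — `δ = 1/4`, `ε = η = 3/128`, `r = r(δ, ε)` from (d), `S₀ = (1 + δ)/2 + ε = 83/128`;
  `Sym_δ ∩ {S_R ≤ t} ⊆ {S_R ≤ t} ∩ {pairMass r (U 0) ≤ S₀}` (the open line `openLine 0 U` IS `tr (U 0)/N`), the profile-resolved bound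
  at `S₀`, and the margin `e = (3/4 − η)S₀ + (1 − η)(1 − S₀) > 3/4`; `t > 1` is trivial since `ekHaar` is a probability measure.
* `tripleSmallBallMargin_of_levels : FreeTripleSmallBall → OffBlockDecoupling → TripleSmallBallMargin` — the route's crux BY NAME
  modulo its two registered stubs (a), (b), which carry all the random-matrix content and are NOT proved here.
-/

set_option autoImplicit false

noncomputable section

open MeasureTheory Filter Topology
open scoped Classical
open Literature.Barriers.QuantumFields

namespace Summit.QuantumFields.YangMills.Theorems.EguchiKawaiDirectionLadder

/-! ### Spectral bookkeeping for `spec U` -/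

/-- `card (spec U) = N` (the characteristic polynomial splits over `ℂ`). -/
theorem card_spec {N : ℕ} (U : UN N) : Multiset.card (spec U) = N := by
  have hsplit : (U : Matrix (Fin N) (Fin N) ℂ).charpoly.Splits := IsAlgClosed.splits _
  unfold spec
  rw [← hsplit.natDegree_eq_card_roots, Matrix.charpoly_natDegree_eq_dim, Fintype.card_fin]

open scoped Matrix.Norms.L2Operator in
/-- Eigenvalues of a unitary matrix lie on the unit circle (`Unitary.spectrum_subset_circle` for the
`C⋆`-algebra `Matrix (Fin N) (Fin N) ℂ` with the `ℓ²`-operator norm). -/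
theorem norm_eq_one_of_mem_spec {N : ℕ} (U : UN N) {w : ℂ} (hw : w ∈ spec U) : ‖w‖ = 1 := by
  have hr : Polynomial.IsRoot (U : Matrix (Fin N) (Fin N) ℂ).charpoly w :=
    (Polynomial.mem_roots (Matrix.charpoly_monic _).ne_zero).1 hw
  have hsp : w ∈ spectrum ℂ (U : Matrix (Fin N) (Fin N) ℂ) :=
    Matrix.mem_spectrum_iff_isRoot_charpoly.mpr hr
  have hU : (U : Matrix (Fin N) (Fin N) ℂ) ∈ unitary (Matrix (Fin N) (Fin N) ℂ) := U.2
  have hsub := Unitary.spectrum_subset_circle (𝕜 := ℂ)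
    (⟨(U : Matrix (Fin N) (Fin N) ℂ), hU⟩ : unitary (Matrix (Fin N) (Fin N) ℂ))
  have := hsub hsp
  simpa using this

/-- `tr U = Σ spec U`. -/
theorem trace_eq_sum_spec {N : ℕ} (U : UN N) :
    Matrix.trace (U : Matrix (Fin N) (Fin N) ℂ) = (spec U).sum :=
  Matrix.trace_eq_sum_roots_charpoly _


open PairMassCount in
/-- Glue obligation (d) `CentreSymmetricProfile` PROVED (planner ym-idea-2 g6's proof, re-homed): centre symmetry
`‖tr U/N‖² ≤ δ` of one link caps its spectral pair mass at resolution `r = min(ε,1/2)/(2(2K+3))`, `K = ⌈4/min(ε,1/2)⌉`, by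
`(1 + δ)/2 + ε`, uniformly in `N`. -/
theorem centreSymmetricProfile_proof : CentreSymmetricProfile := by
  intro δ ε hδ hδh hε
  set ε' : ℝ := min ε (1 / 2) with hε'
  have hε'pos : 0 < ε' := lt_min hε (by norm_num)
  have hε'le : ε' ≤ 1 / 2 := min_le_right _ _
  have hε'ε : ε' ≤ ε := min_le_left _ _
  set K : ℕ := ⌈4 / ε'⌉₊ with hKdef
  have hKpos : 0 < K := Nat.ceil_pos.mpr (by positivity)
  have hKε : 4 / ε' ≤ (K : ℝ) := Nat.le_ceil _
  set r : ℝ := ε' / (2 * (2 * (K : ℝ) + 3)) with hrdef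
  have hden : (0 : ℝ) < 2 * (2 * (K : ℝ) + 3) := by positivity
  have hr : 0 < r := div_pos hε'pos hden
  have hR : (2 * (K : ℝ) + 3) * r ≤ ε' / 2 := by
    have : (2 * (K : ℝ) + 3) * (ε' / (2 * (2 * (K : ℝ) + 3))) = ε' / 2 := by
      field_simp
    rw [hrdef, this]
  refine ⟨r, hr, fun N hN U hU => ?_⟩
  have hNr : (0 : ℝ) < N := by exact_mod_cast hN
  have hcard := card_spec U
  have htr : ‖(spec U).sum‖ ≤ Real.sqrt δ * N := by
    have h1 : ‖Matrix.trace (U : Matrix (Fin N) (Fin N) ℂ) / (N : ℂ)‖ = ‖(spec U).sum‖ / N := by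
      rw [norm_div, trace_eq_sum_spec, Complex.norm_natCast]
    have h2 : ‖(spec U).sum‖ / N ≤ Real.sqrt δ := by
      rw [← h1, ← Real.sqrt_sq (norm_nonneg _)]
      exact Real.sqrt_le_sqrt hU
    rwa [div_le_iff₀ hNr] at h2
  have hcore := sum_ballCount_le (spec U) hN hKpos hcard (fun w hw => norm_eq_one_of_mem_spec U hw)
    hδ.le (by linarith) hε'pos hr hKε hR hε'le htr
  have hpm : pairMass r U =
      ((spec U).map fun z => (Multiset.card ((spec U).filter fun w => ‖z - w‖ ≤ r) : ℝ)).sum / (N : ℝ) ^ 2 := rfl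
  rw [hpm, div_le_iff₀ (by positivity)]
  calc ((spec U).map fun z => (Multiset.card ((spec U).filter fun w => ‖z - w‖ ≤ r) : ℝ)).sum
      ≤ ((1 + δ) / 2 + ε') * (N : ℝ) ^ 2 := hcore
    _ ≤ ((1 + δ) / 2 + ε) * (N : ℝ) ^ 2 := mul_le_mul_of_nonneg_right (by linarith) (by positivity)

/-- Glue obligation (c) `MarginComposition` PROVED (planner ym-idea-2 g6's proof, re-homed): parameter choice `δ = 1/4`,
`ε = η = 3/128`, the inclusion `Sym_δ ∩ {S_R ≤ t} ⊆ {S_R ≤ t} ∩ {pairMass r (U 0) ≤ S₀}` and the margin arithmetic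
(`e = (3/4 − η)S₀ + (1 − η)(1 − S₀) > 3/4` at `S₀ = 83/128`); concludes the ROUTE decl `TripleSmallBallMargin`. -/
theorem marginComposition_proof : MarginComposition := by
  intro hd hb
  have hδ : (0 : ℝ) < 1 / 4 := by norm_num
  obtain ⟨r, hr, hcsp⟩ := hd (1 / 4) (3 / 128) hδ (by norm_num) (by norm_num)
  obtain ⟨C, hC0, N₀, hprb⟩ := hb (3 / 128) r (by norm_num) hr
  set S₀ : ℝ := (1 + 1 / 4) / 2 + 3 / 128 with hS₀
  set e : ℝ := (3 / 4 - 3 / 128) * S₀ + (1 - 3 / 128) * (1 - S₀) with he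
  have he34 : (3 : ℝ) / 4 < e := by rw [he, hS₀]; norm_num
  have he0 : 0 < e := lt_trans (by norm_num) he34
  refine ⟨1 / 4, e, C, hδ, he34, max N₀ 1, fun N hN t ht => ?_⟩
  have hN₀ : N₀ ≤ N := le_trans (le_max_left _ _) hN
  have hN1 : 0 < N := lt_of_lt_of_le Nat.one_pos (le_trans (le_max_right _ _) hN)
  by_cases ht1 : t ≤ 1
  · have hsub : ekSymRegion 3 N (1 / 4) ∩ {U | ekAction U ≤ t} ⊆
        {U | ekAction U ≤ t} ∩ {U : EKConfig 3 N | pairMass r (U 0) ≤ S₀} := by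
      intro U hU
      refine ⟨hU.2, ?_⟩
      have hsym : ‖openLine 0 U‖ ^ 2 ≤ 1 / 4 := hU.1 0
      have h := hcsp N hN1 (U 0) (by simpa [openLine] using hsym)
      show pairMass r (U 0) ≤ S₀
      rw [hS₀]; exact h
    calc ekHaar 3 N (ekSymRegion 3 N (1 / 4) ∩ {U | ekAction U ≤ t})
        ≤ ekHaar 3 N ({U | ekAction U ≤ t} ∩ {U : EKConfig 3 N | pairMass r (U 0) ≤ S₀}) :=
          measure_mono hsub
      _ ≤ ENNReal.ofReal (Real.exp ((N : ℝ) ^ 2 *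
            (((3 / 4 - 3 / 128) * S₀ + (1 - 3 / 128) * (1 - S₀)) * Real.log t + C))) :=
          hprb N hN₀ t ht ht1 S₀
      _ = ENNReal.ofReal (Real.exp ((N : ℝ) ^ 2 * (e * Real.log t + C))) := by rw [he]
  · push Not at ht1
    have hlog : 0 < Real.log t := Real.log_pos ht1
    have hx : 0 ≤ (N : ℝ) ^ 2 * (e * Real.log t + C) := by positivity
    have hexp : (1 : ℝ) ≤ Real.exp ((N : ℝ) ^ 2 * (e * Real.log t + C)) := Real.one_le_exp hx
    calc ekHaar 3 N (ekSymRegion 3 N (1 / 4) ∩ {U | ekAction U ≤ t}) ≤ 1 := prob_le_one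
      _ = ENNReal.ofReal 1 := ENNReal.ofReal_one.symm
      _ ≤ ENNReal.ofReal (Real.exp ((N : ℝ) ^ 2 * (e * Real.log t + C))) :=
          ENNReal.ofReal_le_ofReal hexp


/-- The route's crux `TripleSmallBallMargin` BY NAME modulo its two registered stubs (a) `FreeTripleSmallBall` and
(b) `OffBlockDecoupling` — the glue (d), (c) being discharged above.  Nothing is claimed about (a), (b). -/
theorem tripleSmallBallMargin_of_levels (ha : FreeTripleSmallBall) (hb : OffBlockDecoupling) :
    Summit.QuantumFields.YangMills.Theses.EguchiKawaiDirectionLadder.TripleSmallBallMargin :=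
  tripleSmallBallMargin_of_stubs ha hb centreSymmetricProfile_proof marginComposition_proof

end Summit.QuantumFields.YangMills.Theorems.EguchiKawaiDirectionLadder

end
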